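import Summits.HodgeConjecture.HodgeConjecture.Theorems.R90S6TwistedShellSymmetries    -- ★ (T4-SYM) (brings ★ J2′ `mul_mul_mem_doubleCoset_iff`, ★ L1 `qsInvolution_inv`∕`_mem_glInt`, ★ L2 `twistFrame_twistFrame`,
                                                                                       --   `qsInvolution_qsInvolution`, `relPos_eq_const_iff_latt_eq`, ★ L1 F3 `v_det_qsInvolution`, `v_det_eq_one_of_mem_glInt`)
import Summits.HodgeConjecture.HodgeConjecture.Theorems.R90S6ApartmentTwistedShell      -- ★ TL4 (A.1) `qsInvolution_diagonalGL`, (A.2) `diagonalGL_mem_doubleCoset_iff_exists_perm`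
import Literature.NumberTheory.Automorphic.UnitaryLatticeTreeTypeTwoGram                -- ★ `isIntMatrix_mul`
import Literature.NumberTheory.Automorphic.ValuedFieldValuativeRelBridge                -- ★ `v_lt_one_iff_valuation_lt_one`
import HarnessLib

/-!
# R90 · S6 «Ch. 14.1–14.5 stable trace formula» — card (T4-NS) FILE A (row E1.4.4.2.2): THE SUPPORT BOUND OF THE TWISTED SHELL AND `inv(Λ, γΛ) = (1,0,−1)` ON THE
# NON-SPLIT FIRST SHELL (`Theorems/R90S6TwistedShellSupportBound.lean`)

Cell `hodgecm-mathlib`, crux H413 (`stmt-HodgeConjecture-24833`), route of record `HCCMUnconditional`; programme R90-TF, section S6 (base `R90-C14`, dealer R90-C14-plan (g3)),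
seat R90-C14-p04 (g3); card **(T4-NS)** (RULINGS #19 (R54) 2026-09-05T03:55:28Z), FILE A of two: the heads (T4.5) :235 and (T4.6-i) :244 of typ2 (g3)'s (T4) SHEET OF RECORD v2.3
`R90/R90-C14-typ2/g3/S6_T4_TwistedEllipticCount_Targets.v2.0f48cf5c7bade6f2.lean` §4, statements byte-identical; FILE B `Theorems/R90S6TwistedFirstShellNonsplit.lean` carries
(T4.6-ii)(T4.6-iii).  Lane `--kind proof --supports stmt-HodgeConjecture-24833 --as helper`; THEOREMS ONLY over ★ `Theorems` ∕ Literature ∕ Mathlib carriers (no definition, no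
instance, no notation, no named fact, no kit, no `sorry`).

LETTERS (★ J1′ ∕ ★ J2′ ∕ ★ L2 ∕ ★ (T4-SYM)): `K` a valued field (`Valued K ℤᵐ⁰` + compatible `ValuativeRel K` whose integers form a DVR, uniformizing element `ϖ`), `Θ_σ =
UnitaryGroup.qsInvolution σ`, `K̃ = glInt N K = GL_N(𝒪)`, `ϖ^a = zpowDiagGL hϖ.ne_zero a`; for a base point `δ′`: the frame map `τg := δ′·Θ_σ(g)` (`τΛ = δ′Λ^♯`), the norm
`γ := Nδ′ = δ′·Θ_σ(δ′)` (`τ(τg) = γ·g`, ★ L2 `twistFrame_twistFrame`, `σ` an involution), the twisted shell condition `g⁻¹·τg ∈ K̃ϖ^aK̃` («`gK̃ ∈ Shell(δ′, a)`», i.e.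
`inv(Λ, τΛ) = a` for `Λ = g·𝒪^N`, ★ J2′), and `inv(Λ, γΛ) = relPos hϖ g (γ·g)` (★ L1).  NO normalisation `v ϖ = exp(−1)` is assumed anywhere (the sheet's heads carry none):
valuations of `ϖ`-powers are read through `0 < v ϖ < 1` only.

THE MATHEMATICS ([Macdonald1995] Ch. V §2 (2.2)–(2.6): the shells `Kϖ^aK` and the elementary divisors of a pair of lattices; [Kottwitz1986BaseChangeUnits] §3; [Serre1980Trees]
II.1.1 (`Λ′ ⊆ ϖ^mΛ` as integrality of `ϖ^{−m}g⁻¹g′`)):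
* §1 (integrality currency ★ `IsIntMatrix`, any `N`, no DVR) `v_uniformizer_pos`, `v_uniformizer_lt_one`, `v_zpow_uniformizer_le_one_iff` (`v(ϖ^n) ≤ 1 ⟺ 0 ≤ n`),
  `isIntMatrix_coe_zpowDiagGL_iff` (`ϖ^a` integral ⟺ `a ≥ 0`), **`isIntMatrix_coe_zpowDiagGL_const_mul_of_mem_doubleCoset`** («`x ∈ K̃ϖ^aK̃`, `m ≤ a_i ∀ i` ⇒ `ϖ^{−m·1}·x`
  integral», i.e. `Λ′ ⊆ ϖ^mΛ` when `inv(Λ,Λ′) ≥ m`), `isIntMatrix_coe_zpowDiagGL_const_mul_mul` (products add the bounds), `inv_mem_doubleCoset_zpowDiagGL_neg`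
  (`(K̃ϖ^aK̃)⁻¹ = K̃ϖ^{−a}K̃`);
* §2 (DVR: `relPos`) **`le_relPos_of_isIntMatrix`** ∕ **`relPos_le_of_isIntMatrix`** («`ϖ^{−m·1}·g⁻¹g′` integral ⇒ `m ≤ inv(Λ,Λ′)_i ∀ i`» and the mirror image through ★ L1
  `relPos_swap`), `v_det_coe_zpowDiagGL_eq_zpow_sum` (`v det ϖ^a = (v ϖ)^{Σa}`), **`sum_relPos_eq_zero_of_v_det_eq`** (`v det g = v det g′ ⇒ Σ_i inv(Λ,Λ′)_i = 0` — the
  normalisation-free twin of ★ L1 F3 `sum_relPos_eq_log_sub_log`), `qsInvolution_zpowDiagGL_mem_doubleCoset_neg_rev` ∕ **`qsInvolution_mem_doubleCoset_zpowDiagGL_neg_rev`**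
  (`Θ_σ(K̃ϖ^aK̃) ⊆ K̃ϖ^{−w₀a}K̃` for `σ` valuation-preserving WITHOUT `σϖ = ϖ` — valuations absorb the unit `σ(ϖ)∕ϖ`, ★ TL4 (A.1)+(A.2); the `σϖ = ϖ` edition is ★ (T4-SYM)
  `qsInvolution_mem_doubleCoset_neg_rev`);
* §3 **(T4.5) `relPos_norm_mul_bounds_of_mem_twistedShell`** (`N = 3`): `gK̃ ∈ Shell(δ′, a)`, `a` antitone ⇒ every entry of `inv(Λ, γΛ)` lies in `[a₂ − a₀, a₀ − a₂]` —
  `g⁻¹γg = x·Θ_σ(x)` with `x = g⁻¹τg ∈ K̃ϖ^aK̃`, `Θ_σ x ∈ K̃ϖ^{−w₀a}K̃`, so `ϖ^{−(a₂−a₀)}·g⁻¹γg` and `ϖ^{(a₀−a₂)}·(g⁻¹γg)⁻¹` are integral (the triangle inequality of the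
  building, `inv(Λ, γΛ) ≼ a + (−w₀a)`);
* §4 **(T4.6-i) `relPos_norm_mul_eq_of_mem_twistedShell_one_zero_zero`** (`N = 3`): at `a = (1,0,0)` and `γΛ ≠ Λ`: `inv(Λ, γΛ) = (1,0,−1)` — entries in `[−1,1]` by (T4.5),
  `Σ = 0` by §2 (`v det γ = v det δ′·(v det δ′)⁻¹ = 1`, ★ L1 F3 `v_det_qsInvolution`), antitone ⇒ `inv ∈ {0, (1,0,−1)}`; `inv = 0 ⟺ γΛ = Λ` (★ L2
  `relPos_eq_const_iff_latt_eq`), excluded.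
HONEST LABEL: first-shell support ∕ non-split lattice layer for DAG row E1.4.4.2.2, count-neutral until the D1 values (T4.7)–(T4.10) consume it; proves no printed global
statement, discharges no citation; HC_CM is proved only modulo the 7 printed citations (2 remaining named inputs: hLiu418 = stmt-HodgeConjecture-24832, h413 =
stmt-HodgeConjecture-24833) until rung 0 closes.

## References
* [Macdonald1995] I. G. Macdonald, *Symmetric Functions and Hall Polynomials*, 2nd ed. (1995): Ch. V §2 (2.2) (unique antitone representative `π^λ` of `KxK`), (2.6)
  (`G ∕ K` = lattices, relative position of a pair of lattices).
* [Kottwitz1986BaseChangeUnits] R. E. Kottwitz, *Base change for unit elements of Hecke algebras*, Compositio Math. 60 (1986): §1 pp. 240–242 (`Nδ`, the twisted action on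
  lattices), §3 (the lattice count at a twisted shell).
* [Serre1980Trees] J.-P. Serre, *Trees* (1980): Ch. II §1.1 (lattices, `Λ′ ⊆ Λ ⟺ g⁻¹g′` integral, distance).
-/

set_option autoImplicit false
-- the mandated namespace repeats the single-problem summit's segment (`HodgeConjecture.HodgeConjecture`)
set_option linter.dupNamespace false

noncomputable section

open scoped Matrix MatrixGroups Valued WithZero Pointwise
open Literature.NumberTheory.Automorphic Literature.NumberTheory.Automorphic.HermitianLattice Literature.NumberTheory.Automorphic.UnitaryLatticeTree

namespace Summit.HodgeConjecture.HodgeConjecture.R90.S6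

/-! ## §0 Two bookkeeping lemmas -/

section Prelim

variable {K : Type} [Field K] [ValuativeRel K] {N : ℕ}

/-- Membership in the pointwise-product shell `K̃·{d}·K̃` unfolded (Mathlib `DoubleCoset.mem_doubleCoset`). [cite: Macdonald1995, Ch. V §2 (2.6)] -/
private theorem mem_glIntShell_iff (d x : GL (Fin N) K) :
    x ∈ (glInt N K : Set (GL (Fin N) K)) * {d} * (glInt N K : Set (GL (Fin N) K)) ↔ ∃ k₁ ∈ glInt N K, ∃ k₂ ∈ glInt N K, x = k₁ * d * k₂ :=
  DoubleCoset.mem_doubleCoset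

/-- `∏_i u^{f i} = u^{Σ_i f i}` for `u ≠ 0` in `ℤᵐ⁰` (`zpow_add₀`). [cite: Serre1980Trees, II.1.1] -/
private theorem prod_zpow_eq_zpow_sum {u : ℤᵐ⁰} (hu : u ≠ 0) {ι : Type} (s : Finset ι) (f : ι → ℤ) :
    ∏ i ∈ s, u ^ f i = u ^ (∑ i ∈ s, f i) := by
  induction s using Finset.cons_induction with
  | empty => simp
  | cons a s ha ih => rw [Finset.prod_cons, Finset.sum_cons, ih, zpow_add₀ hu]

end Prelim

/-! ## §1 Integrality of `ϖ^{−m·1}·x` on a Cartan shell (no DVR hypothesis) -/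

section Integral

variable {K : Type} [Field K] [Valued K ℤᵐ⁰] [ValuativeRel K] [(Valued.v : Valuation K ℤᵐ⁰).Compatible] {N : ℕ}
  {ϖ : K} (hϖ : IsUniformizingElement ϖ)
include hϖ

omit [(Valued.v : Valuation K ℤᵐ⁰).Compatible] in
/-- `0 < v ϖ` (`ϖ ≠ 0`). [cite: Serre1980Trees, II.1.1] -/
theorem v_uniformizer_pos : 0 < Valued.v ϖ :=
  zero_lt_iff.2 ((Valuation.ne_zero_iff _).2 hϖ.ne_zero)

/-- `v ϖ < 1` (a uniformizing element lies in the maximal ideal; ★ `IsUniformizingElement.valuation_lt_one` read in `Valued` currency through ★ `v_lt_one_iff_valuation_lt_one`).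
[cite: Serre1980Trees, II.1.1] -/
theorem v_uniformizer_lt_one : Valued.v ϖ < 1 :=
  (v_lt_one_iff_valuation_lt_one ϖ).2 hϖ.valuation_lt_one

/-- **`v(ϖ^n) ≤ 1 ⟺ 0 ≤ n`** (`0 < v ϖ < 1`; normalisation-free). [cite: Serre1980Trees, II.1.1] -/
theorem v_zpow_uniformizer_le_one_iff (n : ℤ) : Valued.v (ϖ ^ n) ≤ 1 ↔ 0 ≤ n := by
  rw [map_zpow₀]
  exact zpow_le_one_iff_right_of_lt_one₀ (v_uniformizer_pos hϖ) (v_uniformizer_lt_one hϖ)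

/-- **`ϖ^a` is an integral matrix iff `a ≥ 0`** (★ `IsIntMatrix`: all entries of valuation `≤ 1`). [cite: Serre1980Trees, II.1.1] -/
theorem isIntMatrix_coe_zpowDiagGL_iff (a : Fin N → ℤ) :
    IsIntMatrix ((zpowDiagGL hϖ.ne_zero a : GL (Fin N) K) : Matrix (Fin N) (Fin N) K) ↔ ∀ i, 0 ≤ a i := by
  constructor
  · intro h i
    have hi := h i i
    rw [coe_zpowDiagGL, Matrix.diagonal_apply_eq] at hi
    exact (v_zpow_uniformizer_le_one_iff hϖ (a i)).1 hi
  · intro h i j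
    rw [coe_zpowDiagGL, Matrix.diagonal_apply]
    split_ifs with hij
    · exact (v_zpow_uniformizer_le_one_iff hϖ (a i)).2 (h i)
    · rw [map_zero]
      exact zero_le

/-- **`inv(Λ, Λ′) ≥ m ⟹ Λ′ ⊆ ϖ^m·Λ`, matrix form**: if `x ∈ K̃·ϖ^a·K̃` and `m ≤ a_i` for all `i` then `ϖ^{−m·1}·x` is an integral matrix — `ϖ^{−m·1}·(k₁ϖ^ak₂) = k₁·ϖ^{a − m·1}·k₂`
(`ϖ^{−m·1}` central, ★ `mul_zpowDiagGL_const_comm`) is a product of integral matrices (★ W7-f `mem_glInt_iff_isIntMatrix`, ★ `isIntMatrix_mul`). [cite: Serre1980Trees, II.1.1]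
[cite: Macdonald1995, Ch. V §2 (2.6)] -/
theorem isIntMatrix_coe_zpowDiagGL_const_mul_of_mem_doubleCoset {a : Fin N → ℤ} {x : GL (Fin N) K}
    (hx : x ∈ (glInt N K : Set (GL (Fin N) K)) * {zpowDiagGL hϖ.ne_zero a} * (glInt N K : Set (GL (Fin N) K))) {m : ℤ} (hm : ∀ i, m ≤ a i) :
    IsIntMatrix ((zpowDiagGL hϖ.ne_zero (fun _ : Fin N => -m) * x : GL (Fin N) K) : Matrix (Fin N) (Fin N) K) := by
  obtain ⟨k₁, hk₁, k₂, hk₂, rfl⟩ := (mem_glIntShell_iff _ x).1 hx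
  have e : zpowDiagGL hϖ.ne_zero (fun _ : Fin N => -m) * (k₁ * zpowDiagGL hϖ.ne_zero a * k₂) =
      k₁ * zpowDiagGL hϖ.ne_zero ((fun _ : Fin N => -m) + a) * k₂ := by
    rw [zpowDiagGL_add]
    calc zpowDiagGL hϖ.ne_zero (fun _ : Fin N => -m) * (k₁ * zpowDiagGL hϖ.ne_zero a * k₂)
        = (zpowDiagGL hϖ.ne_zero (fun _ : Fin N => -m) * k₁) * zpowDiagGL hϖ.ne_zero a * k₂ := by group
      _ = (k₁ * zpowDiagGL hϖ.ne_zero (fun _ : Fin N => -m)) * zpowDiagGL hϖ.ne_zero a * k₂ := by rw [mul_zpowDiagGL_const_comm hϖ.ne_zero (-m) k₁]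
      _ = k₁ * (zpowDiagGL hϖ.ne_zero (fun _ : Fin N => -m) * zpowDiagGL hϖ.ne_zero a) * k₂ := by group
  rw [e, Units.val_mul, Units.val_mul]
  refine isIntMatrix_mul (isIntMatrix_mul ((mem_glInt_iff_isIntMatrix k₁).1 hk₁).1 ((isIntMatrix_coe_zpowDiagGL_iff hϖ _).2 fun i => ?_))
    ((mem_glInt_iff_isIntMatrix k₂).1 hk₂).1
  have hi := hm i
  simp only [Pi.add_apply]
  omega

omit [(Valued.v : Valuation K ℤᵐ⁰).Compatible] in
/-- **Products add the integrality bounds**: `ϖ^{m·1}·y` and `ϖ^{n·1}·z` integral ⇒ `ϖ^{(m+n)·1}·(y·z)` integral (`ϖ^{(m+n)·1}·yz = (ϖ^{m·1}y)·(ϖ^{n·1}z)` by centrality).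
[cite: Serre1980Trees, II.1.1] -/
theorem isIntMatrix_coe_zpowDiagGL_const_mul_mul {y z : GL (Fin N) K} {m n : ℤ}
    (hy : IsIntMatrix ((zpowDiagGL hϖ.ne_zero (fun _ : Fin N => m) * y : GL (Fin N) K) : Matrix (Fin N) (Fin N) K))
    (hz : IsIntMatrix ((zpowDiagGL hϖ.ne_zero (fun _ : Fin N => n) * z : GL (Fin N) K) : Matrix (Fin N) (Fin N) K)) :
    IsIntMatrix ((zpowDiagGL hϖ.ne_zero (fun _ : Fin N => m + n) * (y * z) : GL (Fin N) K) : Matrix (Fin N) (Fin N) K) := by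
  have e : zpowDiagGL hϖ.ne_zero (fun _ : Fin N => m + n) * (y * z) =
      (zpowDiagGL hϖ.ne_zero (fun _ : Fin N => m) * y) * (zpowDiagGL hϖ.ne_zero (fun _ : Fin N => n) * z) := by
    rw [show (fun _ : Fin N => m + n) = (fun _ : Fin N => m) + fun _ : Fin N => n from rfl, zpowDiagGL_add]
    calc zpowDiagGL hϖ.ne_zero (fun _ : Fin N => m) * zpowDiagGL hϖ.ne_zero (fun _ : Fin N => n) * (y * z)
        = zpowDiagGL hϖ.ne_zero (fun _ : Fin N => m) * (zpowDiagGL hϖ.ne_zero (fun _ : Fin N => n) * y) * z := by group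
      _ = zpowDiagGL hϖ.ne_zero (fun _ : Fin N => m) * (y * zpowDiagGL hϖ.ne_zero (fun _ : Fin N => n)) * z := by
          rw [mul_zpowDiagGL_const_comm hϖ.ne_zero n y]
      _ = (zpowDiagGL hϖ.ne_zero (fun _ : Fin N => m) * y) * (zpowDiagGL hϖ.ne_zero (fun _ : Fin N => n) * z) := by group
  rw [e, Units.val_mul]
  exact isIntMatrix_mul hy hz

omit [Valued K ℤᵐ⁰] [(Valued.v : Valuation K ℤᵐ⁰).Compatible] in
/-- **`(K̃·ϖ^a·K̃)⁻¹ = K̃·ϖ^{−a}·K̃`**: `x ∈ K̃ϖ^aK̃ ⟹ x⁻¹ ∈ K̃ϖ^{−a}K̃` (`(k₁ϖ^ak₂)⁻¹ = k₂⁻¹ϖ^{−a}k₁⁻¹`, ★ `zpowDiagGL_neg`). [cite: Macdonald1995, Ch. V §2 (2.6)] -/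
theorem inv_mem_doubleCoset_zpowDiagGL_neg {a : Fin N → ℤ} {x : GL (Fin N) K}
    (hx : x ∈ (glInt N K : Set (GL (Fin N) K)) * {zpowDiagGL hϖ.ne_zero a} * (glInt N K : Set (GL (Fin N) K))) :
    x⁻¹ ∈ (glInt N K : Set (GL (Fin N) K)) * {zpowDiagGL hϖ.ne_zero (-a)} * (glInt N K : Set (GL (Fin N) K)) := by
  obtain ⟨k₁, hk₁, k₂, hk₂, rfl⟩ := (mem_glIntShell_iff _ x).1 hx
  exact (mem_glIntShell_iff _ _).2 ⟨k₂⁻¹, (glInt N K).inv_mem hk₂, k₁⁻¹, (glInt N K).inv_mem hk₁, by rw [zpowDiagGL_neg]; group⟩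

end Integral

/-! ## §2 Bounds on `relPos` from integrality; `Σ_i relPos = 0` from determinants; `Θ_σ` of a shell without `σϖ = ϖ` -/

section Bounds

variable {K : Type} [Field K] [Valued K ℤᵐ⁰] [ValuativeRel K] [(Valued.v : Valuation K ℤᵐ⁰).Compatible] {σ : K →+* K} {N : ℕ}
  [IsDiscreteValuationRing (ValuativeRel.valuation K).integer] {ϖ : K} (hϖ : IsUniformizingElement ϖ)
include hϖ

/-- **`Λ′ ⊆ ϖ^m·Λ ⟹ inv(Λ, Λ′) ≥ m`**: if `ϖ^{−m·1}·(g⁻¹g′)` is an integral matrix then `m ≤ relPos hϖ g g′ i` for every `i` — with ★ L1 `relPos_spec` (`k₁(g⁻¹g′)k₂ = ϖ^c`,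
`c = relPos`) the matrix `ϖ^{c − m·1} = k₁·(ϖ^{−m·1}g⁻¹g′)·k₂` is integral, so `v(ϖ^{c_i − m}) ≤ 1`, i.e. `c_i ≥ m` (`0 < v ϖ < 1`). [cite: Macdonald1995, Ch. V §2 (2.2), (2.6)]
[cite: Serre1980Trees, II.1.1] -/
theorem le_relPos_of_isIntMatrix (g g' : GL (Fin N) K) {m : ℤ}
    (hint : IsIntMatrix ((zpowDiagGL hϖ.ne_zero (fun _ : Fin N => -m) * (g⁻¹ * g') : GL (Fin N) K) : Matrix (Fin N) (Fin N) K)) (i : Fin N) :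
    m ≤ relPos hϖ g g' i := by
  obtain ⟨-, k₁, hk₁, k₂, hk₂, e⟩ := relPos_spec hϖ g g'
  have e' : zpowDiagGL hϖ.ne_zero ((fun _ : Fin N => -m) + relPos hϖ g g') = k₁ * (zpowDiagGL hϖ.ne_zero (fun _ : Fin N => -m) * (g⁻¹ * g')) * k₂ := by
    rw [zpowDiagGL_add, ← e]
    calc zpowDiagGL hϖ.ne_zero (fun _ : Fin N => -m) * (k₁ * (g⁻¹ * g') * k₂)
        = (zpowDiagGL hϖ.ne_zero (fun _ : Fin N => -m) * k₁) * (g⁻¹ * g') * k₂ := by group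
      _ = (k₁ * zpowDiagGL hϖ.ne_zero (fun _ : Fin N => -m)) * (g⁻¹ * g') * k₂ := by rw [mul_zpowDiagGL_const_comm hϖ.ne_zero (-m) k₁]
      _ = k₁ * (zpowDiagGL hϖ.ne_zero (fun _ : Fin N => -m) * (g⁻¹ * g')) * k₂ := by group
  have hZ : IsIntMatrix ((zpowDiagGL hϖ.ne_zero ((fun _ : Fin N => -m) + relPos hϖ g g') : GL (Fin N) K) : Matrix (Fin N) (Fin N) K) := by
    rw [e', Units.val_mul, Units.val_mul]
    exact isIntMatrix_mul (isIntMatrix_mul ((mem_glInt_iff_isIntMatrix k₁).1 hk₁).1 hint) ((mem_glInt_iff_isIntMatrix k₂).1 hk₂).1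
  have hi := (isIntMatrix_coe_zpowDiagGL_iff hϖ _).1 hZ i
  simp only [Pi.add_apply] at hi
  omega

/-- **`ϖ^M·Λ ⊆ Λ′ ⟹ inv(Λ, Λ′) ≤ M`**: if `ϖ^{M·1}·(g′⁻¹g)` is an integral matrix then `relPos hϖ g g′ i ≤ M` for every `i` (`le_relPos_of_isIntMatrix` for the pair `(g′, g)`
and the swap law ★ L1 `relPos_swap`: `inv(Λ, Λ′) = −w₀·inv(Λ′, Λ)`). [cite: Macdonald1995, Ch. V §2 (2.2), (2.6)] [cite: Serre1980Trees, II.1.1] -/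
theorem relPos_le_of_isIntMatrix (g g' : GL (Fin N) K) {M : ℤ}
    (hint : IsIntMatrix ((zpowDiagGL hϖ.ne_zero (fun _ : Fin N => M) * (g'⁻¹ * g) : GL (Fin N) K) : Matrix (Fin N) (Fin N) K)) (i : Fin N) :
    relPos hϖ g g' i ≤ M := by
  have h' : IsIntMatrix ((zpowDiagGL hϖ.ne_zero (fun _ : Fin N => -(-M)) * (g'⁻¹ * g) : GL (Fin N) K) : Matrix (Fin N) (Fin N) K) := by
    rw [neg_neg]
    exact hint
  have h := le_relPos_of_isIntMatrix hϖ g' g h' (Fin.rev i)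
  rw [relPos_swap hϖ g' g]
  simp only
  omega

omit [(Valued.v : Valuation K ℤᵐ⁰).Compatible] [IsDiscreteValuationRing (ValuativeRel.valuation K).integer] in
/-- **`v(det ϖ^a) = (v ϖ)^{Σ_i a_i}`** (normalisation-free form of ★ L1 F3 `v_det_zpowDiagGL`). [cite: Macdonald1995, Ch. V §2 (2.2)] -/
theorem v_det_coe_zpowDiagGL_eq_zpow_sum (a : Fin N → ℤ) :
    Valued.v ((zpowDiagGL hϖ.ne_zero a : GL (Fin N) K) : Matrix (Fin N) (Fin N) K).det = Valued.v ϖ ^ (∑ i, a i) := by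
  rw [coe_zpowDiagGL, Matrix.det_diagonal, map_prod]
  simp_rw [map_zpow₀]
  exact prod_zpow_eq_zpow_sum ((Valuation.ne_zero_iff _).2 hϖ.ne_zero) _ _

/-- **`v(det(g⁻¹g′)) = (v ϖ)^{Σ_i inv(Λ,Λ′)_i}`** (★ L1 `relPos_spec` + `v det k = 1` on `K̃`, ★ L1 F3 `v_det_eq_one_of_mem_glInt`). [cite: Macdonald1995, Ch. V §2 (2.6)] -/
theorem v_det_inv_mul_eq_zpow_sum_relPos (g g' : GL (Fin N) K) :
    Valued.v ((g⁻¹ * g' : GL (Fin N) K) : Matrix (Fin N) (Fin N) K).det = Valued.v ϖ ^ (∑ i, relPos hϖ g g' i) := by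
  obtain ⟨-, k₁, hk₁, k₂, hk₂, e⟩ := relPos_spec hϖ g g'
  generalize g⁻¹ * g' = y at e ⊢
  have hdet := congrArg (fun z : GL (Fin N) K => Valued.v (z : Matrix (Fin N) (Fin N) K).det) e
  simp only [Units.val_mul, Matrix.det_mul, map_mul, v_det_eq_one_of_mem_glInt hk₁, v_det_eq_one_of_mem_glInt hk₂, one_mul, mul_one] at hdet
  rw [hdet, v_det_coe_zpowDiagGL_eq_zpow_sum hϖ]

/-- **`v det g = v det g′ ⟹ Σ_i inv(Λ, Λ′)_i = 0`** — the normalisation-free twin of ★ L1 F3 `sum_relPos_eq_log_sub_log` (`(v ϖ)^{Σ} = v det(g⁻¹g′) = 1` and `n ↦ (v ϖ)^n` is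
injective as `0 < v ϖ < 1`). [cite: Macdonald1995, Ch. V §2 (2.6)] [cite: Serre1980Trees, II.1.1] -/
theorem sum_relPos_eq_zero_of_v_det_eq (g g' : GL (Fin N) K)
    (h : Valued.v ((g : GL (Fin N) K) : Matrix (Fin N) (Fin N) K).det = Valued.v ((g' : GL (Fin N) K) : Matrix (Fin N) (Fin N) K).det) :
    ∑ i, relPos hϖ g g' i = 0 := by
  have hg' : Valued.v ((g' : GL (Fin N) K) : Matrix (Fin N) (Fin N) K).det ≠ 0 := (Valuation.ne_zero_iff _).2 (Matrix.isUnits_det_units g').ne_zero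
  have hv := v_det_inv_mul_eq_zpow_sum_relPos hϖ g g'
  rw [Units.val_mul, Matrix.det_mul, map_mul, Matrix.coe_units_inv, Matrix.det_nonsing_inv, Ring.inverse_eq_inv', map_inv₀, h, inv_mul_cancel₀ hg'] at hv
  exact (zpow_eq_one_iff_right₀ (v_uniformizer_pos hϖ).le (v_uniformizer_lt_one hϖ).ne).1 hv.symm

/-- **`Θ_σ(ϖ^a) ∈ K̃·ϖ^{−w₀a}·K̃` for `σ` valuation-preserving** (no `σϖ = ϖ`): `Θ_σ(ϖ^a) = diag(σ(ϖ^{a_{rev i}})⁻¹)` (★ TL4 (A.1) `qsInvolution_diagonalGL`) has entries of valuation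
`v(ϖ^{−a_{rev i}})`, so it lies on the shell of `ϖ^{−w₀a}` (★ TL4 (A.2) `diagonalGL_mem_doubleCoset_iff_exists_perm` at the identity permutation) — «valuations absorb the unit
`σ(ϖ)∕ϖ`»; the exact equality `Θ_σ(ϖ^a) = ϖ^{−w₀a}` needs `σϖ = ϖ` (★ L1 `qsInvolution_zpowDiagGL`). [cite: Kottwitz1986BaseChangeUnits, §3] [cite: Macdonald1995, Ch. V §2 (2.2)] -/
theorem qsInvolution_zpowDiagGL_mem_doubleCoset_neg_rev (hvσ : ∀ a, Valued.v (σ a) = Valued.v a) (a : Fin N → ℤ) :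
    UnitaryGroup.qsInvolution σ (zpowDiagGL hϖ.ne_zero a) ∈
      (glInt N K : Set (GL (Fin N) K)) * {zpowDiagGL hϖ.ne_zero (fun i => - a (Fin.rev i))} * (glInt N K : Set (GL (Fin N) K)) := by
  have hΘ : UnitaryGroup.qsInvolution σ (zpowDiagGL hϖ.ne_zero a) =
      diagonalGL (Fin N) K (fun i => (Units.map (σ : K →* K) (Units.mk0 ϖ hϖ.ne_zero ^ a (Fin.rev i)))⁻¹) :=
    qsInvolution_diagonalGL _
  rw [hΘ]
  refine (diagonalGL_mem_doubleCoset_iff_exists_perm hϖ (e := fun i => - a (Fin.rev i)) (fun i => ?_) _).2 ⟨1, fun i => rfl⟩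
  rw [Units.val_inv_eq_inv_val, Units.coe_map, MonoidHom.coe_coe, Units.val_zpow_eq_zpow_val, Units.val_mk0, map_inv₀, hvσ, ← map_inv₀, ← zpow_neg]

/-- **`Θ_σ(K̃·ϖ^a·K̃) ⊆ K̃·ϖ^{−w₀a}·K̃` for `σ` valuation-preserving** (no `σϖ = ϖ`): `Θ_σ(k₁ϖ^ak₂) = Θ_σk₁·Θ_σ(ϖ^a)·Θ_σk₂` with `Θ_σk_i ∈ K̃` (★ L1 `qsInvolution_mem_glInt`) and
`Θ_σ(ϖ^a)` on the shell of `ϖ^{−w₀a}` (`qsInvolution_zpowDiagGL_mem_doubleCoset_neg_rev`; bi-invariance ★ J2′ `mul_mul_mem_doubleCoset_iff`).  So the frame map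
`τ : Λ ↦ δ′Λ^♯` carries `Shell(δ′, a)` to `Shell(δ′, −w₀a)` in the sense `(τg)⁻¹·τ(τg) = Θ_σ(g⁻¹τg)` (★ (T4-SYM)). [cite: Kottwitz1986BaseChangeUnits, §3]
[cite: Macdonald1995, Ch. V §2 (2.6)] -/
theorem qsInvolution_mem_doubleCoset_zpowDiagGL_neg_rev (hvσ : ∀ a, Valued.v (σ a) = Valued.v a) {a : Fin N → ℤ} {x : GL (Fin N) K}
    (hx : x ∈ (glInt N K : Set (GL (Fin N) K)) * {zpowDiagGL hϖ.ne_zero a} * (glInt N K : Set (GL (Fin N) K))) :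
    UnitaryGroup.qsInvolution σ x ∈
      (glInt N K : Set (GL (Fin N) K)) * {zpowDiagGL hϖ.ne_zero (fun i => - a (Fin.rev i))} * (glInt N K : Set (GL (Fin N) K)) := by
  obtain ⟨k₁, hk₁, k₂, hk₂, rfl⟩ := (mem_glIntShell_iff _ x).1 hx
  rw [UnitaryGroup.qsInvolution_mul, UnitaryGroup.qsInvolution_mul]
  exact (mul_mul_mem_doubleCoset_iff _ (qsInvolution_mem_glInt hvσ hk₁) (qsInvolution_mem_glInt hvσ hk₂) _).2
    (qsInvolution_zpowDiagGL_mem_doubleCoset_neg_rev hϖ hvσ a)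

end Bounds

/-! ## §3 (T4.5) The support bound `inv(Λ, γΛ) ∈ [a₂ − a₀, a₀ − a₂]` on `Shell(δ′, a)` — SHEET v2.3 §4 :235 -/

section Support

variable {K : Type} [Field K] [Valued K ℤᵐ⁰] [ValuativeRel K] [(Valued.v : Valuation K ℤᵐ⁰).Compatible] {σ : K →+* K} {N : ℕ}
  [IsDiscreteValuationRing (ValuativeRel.valuation K).integer] {ϖ : K} (hϖ : IsUniformizingElement ϖ)

/-- **(T4.5) SUPPORT BOUND — only lattices near `Fix(γ)` enter** (`N = 3`): if `gK̃ ∈ Shell(δ′, a)` (`a` antitone) then every entry of `inv(Λ, γΛ) = relPos hϖ g (Nδ′·g)`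
(`Nδ′ = δ′Θ_σ(δ′)`, `γΛ = τ(τΛ)` by ★ `twistFrame_twistFrame`) lies in `[a₂ − a₀, a₀ − a₂]` — the triangle inequality of the building: `inv(Λ, γΛ) ≼ a + (−w₀a)`.  So
`#Shell(δ′, a)` only sees the tube of vector-radius `|a|` around `Fix_{B(GL₃,E)}(γ)` (= the apartment `A_T` at depth 0), whence finiteness and polynomiality in `q_E`.
PROOF: `g⁻¹γg = x·Θ_σ x` with `x = g⁻¹τg ∈ K̃ϖ^aK̃` (`Θ_σ² = id`, ★ L2) and `Θ_σ x ∈ K̃ϖ^{−w₀a}K̃` (§2, `σϖ = ϖ` NOT needed); `ϖ^{−a₂}x`, `ϖ^{a₀}Θ_σx` are integral (§1), so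
`ϖ^{−(a₂−a₀)}·g⁻¹γg` is integral ⇒ lower bound (§2 `le_relPos_of_isIntMatrix`); the inverses `x⁻¹ ∈ K̃ϖ^{−a}K̃`, `(Θ_σx)⁻¹ = Θ_σ(x⁻¹)` give `ϖ^{(a₀−a₂)}·(g⁻¹γg)⁻¹` integral ⇒ upper
bound (§2 `relPos_le_of_isIntMatrix`).  (SHEET v2.3 §4 :235, bytes verbatim.) [cite: Macdonald1995, Ch. V §2 (2.6)] [cite: Kottwitz1986BaseChangeUnits, §3] -/
theorem relPos_norm_mul_bounds_of_mem_twistedShell (hvσ : ∀ a, Valued.v (σ a) = Valued.v a) (hσσ : ∀ a, σ (σ a) = a) {a : Fin 3 → ℤ} (ha : Antitone a)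
    {δ' g : GL (Fin 3) K}
    (h : g⁻¹ * δ' * UnitaryGroup.qsInvolution σ g ∈
      (glInt 3 K : Set (GL (Fin 3) K)) * {zpowDiagGL hϖ.ne_zero a} * (glInt 3 K : Set (GL (Fin 3) K))) (i : Fin 3) :
    a 2 - a 0 ≤ relPos hϖ g (δ' * UnitaryGroup.qsInvolution σ δ' * g) i ∧ relPos hϖ g (δ' * UnitaryGroup.qsInvolution σ δ' * g) i ≤ a 0 - a 2 := by
  -- the extreme exponents of the antitone vector `a`
  have ha2 : ∀ j : Fin 3, a 2 ≤ a j := fun j => ha (by fin_cases j <;> decide)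
  have ha0 : ∀ j : Fin 3, a j ≤ a 0 := fun j => ha (by fin_cases j <;> decide)
  -- `x = g⁻¹ τg`, its polar `Θ_σ x`, and their inverses, each on a Cartan shell
  set x : GL (Fin 3) K := g⁻¹ * δ' * UnitaryGroup.qsInvolution σ g with hx
  have hΘx := qsInvolution_mem_doubleCoset_zpowDiagGL_neg_rev hϖ hvσ h
  have hxi := inv_mem_doubleCoset_zpowDiagGL_neg hϖ h
  have hΘxi := qsInvolution_mem_doubleCoset_zpowDiagGL_neg_rev hϖ hvσ hxi
  -- `g⁻¹ γ g = x · Θ_σ x` and its inverse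
  have hprod : g⁻¹ * (δ' * UnitaryGroup.qsInvolution σ δ' * g) = x * UnitaryGroup.qsInvolution σ x := by
    simp only [hx, UnitaryGroup.qsInvolution_mul, qsInvolution_inv, qsInvolution_qsInvolution hσσ]
    group
  have hprod' : (δ' * UnitaryGroup.qsInvolution σ δ' * g)⁻¹ * g = UnitaryGroup.qsInvolution σ x⁻¹ * x⁻¹ := by
    rw [qsInvolution_inv, ← mul_inv_rev, ← hprod]
    group
  -- integrality: `ϖ^{−a₂}x`, `ϖ^{a₀}Θx`, `ϖ^{−a₂}Θ(x⁻¹)`, `ϖ^{a₀}x⁻¹`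
  have h1 := isIntMatrix_coe_zpowDiagGL_const_mul_of_mem_doubleCoset hϖ h (m := a 2) ha2
  have h2 := isIntMatrix_coe_zpowDiagGL_const_mul_of_mem_doubleCoset hϖ hΘx (m := -(a 0)) fun j => neg_le_neg (ha0 (Fin.rev j))
  have h3 := isIntMatrix_coe_zpowDiagGL_const_mul_of_mem_doubleCoset hϖ hΘxi (m := a 2) fun j => by
    simp only [Pi.neg_apply, neg_neg]
    exact ha2 (Fin.rev j)
  have h4 := isIntMatrix_coe_zpowDiagGL_const_mul_of_mem_doubleCoset hϖ hxi (m := -(a 0)) fun j => by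
    simp only [Pi.neg_apply]
    exact neg_le_neg (ha0 j)
  have hlow := isIntMatrix_coe_zpowDiagGL_const_mul_mul hϖ h1 h2
  have hup := isIntMatrix_coe_zpowDiagGL_const_mul_mul hϖ h3 h4
  rw [← hprod, show (fun _ : Fin 3 => -(a 2) + -(-(a 0))) = fun _ : Fin 3 => -(a 2 - a 0) from funext fun _ => by ring] at hlow
  rw [← hprod', show (fun _ : Fin 3 => -(a 2) + -(-(a 0))) = fun _ : Fin 3 => a 0 - a 2 from funext fun _ => by ring] at hup
  exact ⟨le_relPos_of_isIntMatrix hϖ g _ hlow i, relPos_le_of_isIntMatrix hϖ g _ hup i⟩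

/-! ## §4 (T4.6-i) `inv(Λ, γΛ) = (1,0,−1)` on the non-split members of the first shell — SHEET v2.3 §4 :244 -/

/-- **(T4.6-i) FIRST SHELL, NOT `γ`-FIXED ⇒ `inv(Λ, γΛ) = (1,0,−1)`**: if `gK̃ ∈ Shell(δ′, (1,0,0))` (`τΛ ⊂ Λ` of colength 1, and `τΛ ⊂ γΛ` of colength 1 by (T4.2)) and
`γΛ ≠ Λ`, then `Λ ∩ γΛ = τΛ` has colength 1 in both, so `relPos hϖ g (Nδ′·g) = (1,0,−1)`.  PROOF (via (T4.5)): the entries of `c = inv(Λ, γΛ)` lie in `[−1, 1]`; `Σ_i c_i = 0`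
(§2 `sum_relPos_eq_zero_of_v_det_eq`: `v det(γg) = v det δ′·(v det δ′)⁻¹·v det g`, ★ L1 F3 `v_det_qsInvolution`); `c` is antitone (★ L1 `antitone_relPos`); hence `c = 0` or
`c = (1,0,−1)` — and `c = 0 ⟺ γΛ = Λ` (★ L2 `relPos_eq_const_iff_latt_eq` at `c = 0`) is excluded by `hne`.  (SHEET v2.3 §4 :244, bytes verbatim.)
[cite: Macdonald1995, Ch. V §2 (2.6)] [cite: Kottwitz1986BaseChangeUnits, §3] -/
theorem relPos_norm_mul_eq_of_mem_twistedShell_one_zero_zero (hvσ : ∀ a, Valued.v (σ a) = Valued.v a) (hσσ : ∀ a, σ (σ a) = a) (hσϖ : σ ϖ = ϖ)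
    {δ' g : GL (Fin 3) K}
    (h : g⁻¹ * δ' * UnitaryGroup.qsInvolution σ g ∈
      (glInt 3 K : Set (GL (Fin 3) K)) * {zpowDiagGL hϖ.ne_zero ![1, 0, 0]} * (glInt 3 K : Set (GL (Fin 3) K)))
    (hne : latt ((δ' * UnitaryGroup.qsInvolution σ δ' * g : GL (Fin 3) K) : Matrix (Fin 3) (Fin 3) K) ≠ latt ((g : GL (Fin 3) K) : Matrix (Fin 3) (Fin 3) K)) :
    relPos hϖ g (δ' * UnitaryGroup.qsInvolution σ δ' * g) = ![1, 0, -1] := by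
  have _ := hσϖ
  have ha : Antitone (![1, 0, 0] : Fin 3 → ℤ) := fun i j hij => by
    fin_cases i <;> fin_cases j <;> first | decide | exact absurd hij (by decide)
  set c := relPos hϖ g (δ' * UnitaryGroup.qsInvolution σ δ' * g) with hc
  -- entries in `[−1, 1]`
  have hb : ∀ i, -1 ≤ c i ∧ c i ≤ 1 := fun i => by
    have hi := relPos_norm_mul_bounds_of_mem_twistedShell hϖ hvσ hσσ ha h i
    simpa using hi
  -- `Σ c = 0`: `v det (γ g) = v det g`
  have hdet : Valued.v ((g : GL (Fin 3) K) : Matrix (Fin 3) (Fin 3) K).det =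
      Valued.v ((δ' * UnitaryGroup.qsInvolution σ δ' * g : GL (Fin 3) K) : Matrix (Fin 3) (Fin 3) K).det := by
    have hδ : Valued.v ((δ' : GL (Fin 3) K) : Matrix (Fin 3) (Fin 3) K).det ≠ 0 := (Valuation.ne_zero_iff _).2 (Matrix.isUnits_det_units δ').ne_zero
    rw [Units.val_mul, Units.val_mul, Matrix.det_mul, Matrix.det_mul, map_mul, map_mul, v_det_qsInvolution hvσ, mul_inv_cancel₀ hδ, one_mul]
  have hsum := sum_relPos_eq_zero_of_v_det_eq hϖ g (δ' * UnitaryGroup.qsInvolution σ δ' * g) hdet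
  rw [Fin.sum_univ_three, ← hc] at hsum
  -- antitone
  have hanti : Antitone c := hc ▸ antitone_relPos hϖ g _
  have h10 : c 1 ≤ c 0 := hanti (show (0 : Fin 3) ≤ 1 by decide)
  have h21 : c 2 ≤ c 1 := hanti (show (1 : Fin 3) ≤ 2 by decide)
  have h0 := hb 0
  have h2 := hb 2
  -- casework: `c = 0` or `c = (1, 0, −1)`
  rcases (show (c 0 = 0 ∧ c 1 = 0 ∧ c 2 = 0) ∨ (c 0 = 1 ∧ c 1 = 0 ∧ c 2 = -1) by omega) with hz | hv
  · -- `c = 0` forces `γΛ = Λ`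
    exfalso
    apply hne
    have hc0 : relPos hϖ g (δ' * UnitaryGroup.qsInvolution σ δ' * g) = fun _ : Fin 3 => (0 : ℤ) := by
      rw [← hc]
      funext i
      fin_cases i
      · exact hz.1
      · exact hz.2.1
      · exact hz.2.2
    have hl := (relPos_eq_const_iff_latt_eq hϖ g (δ' * UnitaryGroup.qsInvolution σ δ' * g) 0).1 hc0
    rw [show (fun _ : Fin 3 => (0 : ℤ)) = 0 from rfl, zpowDiagGL_zero, mul_one] at hl
    exact hl
  · funext i
    fin_cases i
    · exact hv.1
    · exact hv.2.1
    · exact hv.2.2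

end Support

end Summit.HodgeConjecture.HodgeConjecture.R90.S6

end
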